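import Summits.PneNP.PneNP.Theorems.ExpanderLinearGeneratorsGridRoutingDefs

/-!
# PneNP / ExpanderLinearGenerators — the grid routing system (definitions and unsolvability)

Route `PneNP/ExpanderLinearGenerators`, support for crux stmt-PneNP-11443
(`LinearGeneratorDepthFregeHard`). The Tseitin system of the ROUTING GRID of the bijective
pigeonhole principle on `k + 2` pigeons and `k + 1` holes: a pigeon terminal `t_u` for every
pigeon `u`, a hole terminal `h_w` for every hole `w`, and a grid point `g(u, w)` for every pair;
row `u` is the path `t_u — g(u,0) — g(u,1) — ⋯ — g(u,k)` (edges `r(u,w)`, entering `g(u,w)`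
from the left) and column `w` the path `h_w — g(0,w) — g(1,w) — ⋯ — g(k+1,w)` (edges `c(u,w)`,
entering `g(u,w)` from above). Terminals carry charge `1`, grid points charge `0`; the total
charge `2k + 3` is odd, so the system (every edge variable in exactly two equations) is
unsolvable. A bijection `f` between pigeons and holes would route pigeon `u` along row `u` to
`g(u, f u)` and up column `f u` to its hole and so solve the system — the Urquhart–Fu / Ben-Sasson
reduction, carried out in the sibling files.

Contents: the index types `RowIdx`, `VarIdx` and their numberings `rowEquiv`, `varEquiv`; the
edge sets `edgesOf`; the system `gridSystem k : Fin (nRows k) → LinEqMod 2 (nVars k)`;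
`holds_gridSystem_iff` (an equation holds iff the sum of its edge values is its charge);
`two_rows_of_edge` (every edge lies in exactly two equations); `not_systemSat_gridSystem`.

References: A. Urquhart, X. Fu, *Simplified lower bounds for propositional proofs*, Notre Dame
J. Formal Logic 37 (1996); E. Ben-Sasson, *Hard examples for the bounded depth Frege proof
system*, Comput. Complexity 11 (2002); J. Håstad, *On small-depth Frege proofs for Tseitin for
grids*, J. ACM 68 (2020).
-/

namespace Summit.PneNP.PneNP.Theorems.GridRouting

set_option linter.dupNamespace false -- `Summit.PneNP.PneNP.…`: summit = sub-problem (D-0017)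

open Finset Literature.Computability.MetaComplexity

variable (k : ℕ)

/-- The number of a row edge. [folklore] -/
theorem varEquiv_inl (u : Fin (k + 2)) (w : Fin (k + 1)) :
    (varEquiv k (Sum.inl (u, w)) : ℕ) = w + (k + 1) * u := by
  simp [varEquiv, finProdFinEquiv]

/-- The number of a column edge. [folklore] -/
theorem varEquiv_inr (u : Fin (k + 2)) (w : Fin (k + 1)) :
    (varEquiv k (Sum.inr (u, w)) : ℕ) = (k + 2) * (k + 1) + (w + (k + 1) * u) := by
  simp [varEquiv, finProdFinEquiv]; ring

/-- **Semantics of an equation**: equation `r` holds for `z` iff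
`Σ_{e ∈ edgesOf r} z_e = charge r`. [folklore] -/
theorem holds_gridSystem_iff (r : RowIdx k) (z : Fin (nVars k) → ZMod 2) :
    (gridSystem k (rowEquiv k r)).Holds z ↔ ∑ e ∈ edgesOf k r, z (varEquiv k e) = charge k r := by
  unfold LinEqMod.Holds gridSystem
  simp only [Equiv.symm_apply_apply]
  rw [show (∑ j, (if (varEquiv k).symm j ∈ edgesOf k r then (1 : ZMod 2) else 0) * z j) =
      ∑ e ∈ edgesOf k r, z (varEquiv k e) from ?_]
  rw [← Equiv.sum_comp (varEquiv k)]
  simp only [Equiv.symm_apply_apply, ite_mul, one_mul, zero_mul]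
  rw [Finset.sum_ite_mem, Finset.univ_inter]

/-- The support of an equation is the image of its edge set. [folklore] -/
theorem supp_gridSystem (r : RowIdx k) :
    (gridSystem k (rowEquiv k r)).supp = (edgesOf k r).map (varEquiv k).toEmbedding := by
  ext j
  simp only [LinEqMod.supp, gridSystem, Equiv.symm_apply_apply, Finset.mem_filter,
    Finset.mem_univ, true_and, ne_eq, ite_eq_right_iff, one_ne_zero, imp_false, not_not,
    Finset.mem_map_equiv]

/-- Every equation has at most `4` variables. [folklore] -/
theorem card_edgesOf_le (r : RowIdx k) : (edgesOf k r).card ≤ 4 := by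
  rcases r with u | w | ⟨u, w⟩
  · simp [edgesOf]
  · simp [edgesOf]
  · simp only [edgesOf]
    refine (Finset.card_union_le _ _).trans ?_
    have h1 : ({Sum.inl (u, w), Sum.inr (u, w)} : Finset (VarIdx k)).card ≤ 2 :=
      Finset.card_le_two
    have h2 : (if h : (w : ℕ) + 1 < k + 1 then ({Sum.inl (u, ⟨w + 1, h⟩)} : Finset (VarIdx k))
        else ∅).card ≤ 1 := by split_ifs <;> simp
    have h3 : (if h : (u : ℕ) + 1 < k + 2 then ({Sum.inr (⟨u + 1, h⟩, w)} : Finset (VarIdx k))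
        else ∅).card ≤ 1 := by split_ifs <;> simp
    have := Finset.card_union_le ({Sum.inl (u, w), Sum.inr (u, w)} : Finset (VarIdx k))
      (if h : (w : ℕ) + 1 < k + 1 then {Sum.inl (u, ⟨w + 1, h⟩)} else ∅)
    omega

/-- **Supports have size at most `4`.** [folklore] -/
theorem card_supp_gridSystem_le (i : Fin (nRows k)) : (gridSystem k i).supp.card ≤ 4 := by
  obtain ⟨r, rfl⟩ := (rowEquiv k).surjective i
  rw [supp_gridSystem, Finset.card_map]
  exact card_edgesOf_le k r

/-! ### Every edge lies in exactly two equations -/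

variable {k}

/-- Row edges at a grid point: `r(u,w)` and `r(u,w+1)`. [folklore] -/
theorem inl_mem_edgesOf_grid {a u : Fin (k + 2)} {b w : Fin (k + 1)} :
    Sum.inl (a, b) ∈ edgesOf k (Sum.inr (Sum.inr (u, w))) ↔ a = u ∧ (b = w ∨ (b : ℕ) = w + 1) := by
  simp only [edgesOf, Finset.mem_union, Finset.mem_insert, Sum.inl.injEq, Prod.mk.injEq,
    Finset.mem_singleton, reduceCtorEq, or_false]
  constructor
  · rintro ((⟨rfl, rfl⟩ | h) | h)
    · exact ⟨rfl, Or.inl rfl⟩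
    · split_ifs at h with hw
      · simp only [Finset.mem_singleton, Sum.inl.injEq, Prod.mk.injEq] at h
        obtain ⟨rfl, rfl⟩ := h
        exact ⟨rfl, Or.inr rfl⟩
      · simp at h
    · split_ifs at h <;> simp at h
  · rintro ⟨rfl, rfl | hb⟩
    · exact Or.inl (Or.inl ⟨rfl, rfl⟩)
    · have hw : (w : ℕ) + 1 < k + 1 := by have := b.2; omega
      refine Or.inl (Or.inr ?_)
      rw [dif_pos hw, Finset.mem_singleton]
      congr 2; exact Fin.ext hb

/-- Column edges at a grid point: `c(u,w)` and `c(u+1,w)`. [folklore] -/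
theorem inr_mem_edgesOf_grid {a u : Fin (k + 2)} {b w : Fin (k + 1)} :
    Sum.inr (a, b) ∈ edgesOf k (Sum.inr (Sum.inr (u, w))) ↔ b = w ∧ (a = u ∨ (a : ℕ) = u + 1) := by
  simp only [edgesOf, Finset.mem_union, Finset.mem_insert, reduceCtorEq, Finset.mem_singleton,
    Sum.inr.injEq, Prod.mk.injEq, false_or]
  constructor
  · rintro ((⟨rfl, rfl⟩ | h) | h)
    · exact ⟨rfl, Or.inl rfl⟩
    · split_ifs at h <;> simp at h
    · split_ifs at h with hu
      · simp only [Finset.mem_singleton, Sum.inr.injEq, Prod.mk.injEq] at h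
        obtain ⟨rfl, rfl⟩ := h
        exact ⟨rfl, Or.inr rfl⟩
      · simp at h
  · rintro ⟨rfl, rfl | ha⟩
    · exact Or.inl (Or.inl ⟨rfl, rfl⟩)
    · have hu : (u : ℕ) + 1 < k + 2 := by have := a.2; omega
      refine Or.inr ?_
      rw [dif_pos hu, Finset.mem_singleton]
      congr 2; exact Fin.ext ha

/-- Row edges at the terminals: only `r(u,0)` at `t_u`. [folklore] -/
theorem inl_mem_edgesOf_pigeon {a u : Fin (k + 2)} {b : Fin (k + 1)} :
    Sum.inl (a, b) ∈ edgesOf k (Sum.inl u) ↔ a = u ∧ (b : ℕ) = 0 := by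
  simp only [edgesOf, Finset.mem_singleton, Sum.inl.injEq, Prod.mk.injEq]
  constructor
  · rintro ⟨rfl, rfl⟩; exact ⟨rfl, rfl⟩
  · rintro ⟨rfl, hb⟩; exact ⟨rfl, Fin.ext hb⟩

/-- No row edge at a hole terminal. [folklore] -/
theorem inl_not_mem_edgesOf_hole {a : Fin (k + 2)} {b w : Fin (k + 1)} :
    Sum.inl (a, b) ∉ edgesOf k (Sum.inr (Sum.inl w)) := by
  simp [edgesOf]

/-- Column edges at the terminals: only `c(0,w)` at `h_w`. [folklore] -/
theorem inr_mem_edgesOf_hole {a : Fin (k + 2)} {b w : Fin (k + 1)} :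
    Sum.inr (a, b) ∈ edgesOf k (Sum.inr (Sum.inl w)) ↔ (a : ℕ) = 0 ∧ b = w := by
  simp only [edgesOf, Finset.mem_singleton, Sum.inr.injEq, Prod.mk.injEq]
  constructor
  · rintro ⟨rfl, rfl⟩; exact ⟨rfl, rfl⟩
  · rintro ⟨ha, rfl⟩; exact ⟨Fin.ext ha, rfl⟩

/-- No column edge at a pigeon terminal. [folklore] -/
theorem inr_not_mem_edgesOf_pigeon {a u : Fin (k + 2)} {b : Fin (k + 1)} :
    Sum.inr (a, b) ∉ edgesOf k (Sum.inl u) := by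
  simp [edgesOf]

variable (k)

/-- The equations containing a row edge. [folklore] -/
theorem filter_inl_mem_edgesOf (u : Fin (k + 2)) (w : Fin (k + 1)) :
    (Finset.univ.filter fun r : RowIdx k => Sum.inl (u, w) ∈ edgesOf k r) = rowEdgeEnds k u w := by
  ext r
  simp only [Finset.mem_filter, Finset.mem_univ, true_and, rowEdgeEnds, Finset.mem_insert,
    Finset.mem_singleton]
  rcases r with u' | w' | ⟨u', w'⟩
  · rw [inl_mem_edgesOf_pigeon]
    constructor
    · rintro ⟨rfl, hb⟩
      right; rw [if_pos hb]
    · rintro (h | h)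
      · cases h
      · by_cases hb : (w : ℕ) = 0
        · rw [if_pos hb] at h; cases h; exact ⟨rfl, hb⟩
        · rw [if_neg hb] at h; cases h
  · simp only [inl_not_mem_edgesOf_hole, false_iff, not_or]
    refine ⟨by simp, ?_⟩
    by_cases hb : (w : ℕ) = 0
    · rw [if_pos hb]; simp
    · rw [if_neg hb]; simp
  · rw [inl_mem_edgesOf_grid]
    constructor
    · rintro ⟨rfl, rfl | hb⟩
      · exact Or.inl rfl
      · right
        rw [if_neg (by omega)]
        congr 3; ext; simp; omega
    · rintro (h | h)
      · cases h; exact ⟨rfl, Or.inl rfl⟩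
      · by_cases hb : (w : ℕ) = 0
        · rw [if_pos hb] at h; cases h
        · rw [if_neg hb] at h; cases h; exact ⟨rfl, Or.inr (by simp; omega)⟩

/-- The equations containing a column edge. [folklore] -/
theorem filter_inr_mem_edgesOf (u : Fin (k + 2)) (w : Fin (k + 1)) :
    (Finset.univ.filter fun r : RowIdx k => Sum.inr (u, w) ∈ edgesOf k r) = colEdgeEnds k u w := by
  ext r
  simp only [Finset.mem_filter, Finset.mem_univ, true_and, colEdgeEnds, Finset.mem_insert,
    Finset.mem_singleton]
  rcases r with u' | w' | ⟨u', w'⟩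
  · simp only [inr_not_mem_edgesOf_pigeon, false_iff, not_or]
    refine ⟨by simp, ?_⟩
    by_cases ha : (u : ℕ) = 0
    · rw [if_pos ha]; simp
    · rw [if_neg ha]; simp
  · rw [inr_mem_edgesOf_hole]
    constructor
    · rintro ⟨ha, rfl⟩
      right; rw [if_pos ha]
    · rintro (h | h)
      · cases h
      · by_cases ha : (u : ℕ) = 0
        · rw [if_pos ha] at h; cases h; exact ⟨ha, rfl⟩
        · rw [if_neg ha] at h; cases h
  · rw [inr_mem_edgesOf_grid]
    constructor
    · rintro ⟨rfl, rfl | ha⟩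
      · exact Or.inl rfl
      · right
        rw [if_neg (by omega)]
        congr 3; ext; simp; omega
    · rintro (h | h)
      · cases h; exact ⟨rfl, Or.inl rfl⟩
      · by_cases ha : (u : ℕ) = 0
        · rw [if_pos ha] at h; cases h
        · rw [if_neg ha] at h; cases h; exact ⟨rfl, Or.inr (by simp; omega)⟩

/-- The two ends of a row edge are distinct. [folklore] -/
theorem card_rowEdgeEnds (u : Fin (k + 2)) (w : Fin (k + 1)) : (rowEdgeEnds k u w).card = 2 := by
  unfold rowEdgeEnds
  rw [Finset.card_pair]
  split_ifs with h
  · simp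
  · intro heq
    have h1 := Prod.mk.inj (Sum.inr.inj (Sum.inr.inj heq))
    have h2 := congrArg Fin.val h1.2
    simp only at h2
    omega

/-- The two ends of a column edge are distinct. [folklore] -/
theorem card_colEdgeEnds (u : Fin (k + 2)) (w : Fin (k + 1)) : (colEdgeEnds k u w).card = 2 := by
  unfold colEdgeEnds
  rw [Finset.card_pair]
  split_ifs with h
  · simp
  · intro heq
    have h1 := Prod.mk.inj (Sum.inr.inj (Sum.inr.inj heq))
    have h2 := congrArg Fin.val h1.1
    simp only at h2
    omega

/-- **Every edge lies in exactly two equations.** [folklore] -/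
theorem card_filter_mem_edgesOf (e : VarIdx k) :
    (Finset.univ.filter fun r : RowIdx k => e ∈ edgesOf k r).card = 2 := by
  rcases e with ⟨u, w⟩ | ⟨u, w⟩
  · rw [filter_inl_mem_edgesOf, card_rowEdgeEnds]
  · rw [filter_inr_mem_edgesOf, card_colEdgeEnds]

/-- The total charge is odd: `(k+2) + (k+1) ≡ 1 (mod 2)`. [folklore] -/
theorem sum_charge : ∑ r : RowIdx k, charge k r = 1 := by
  rw [Fintype.sum_sum_type, Fintype.sum_sum_type]
  simp only [charge, Finset.sum_const, Finset.card_univ, Fintype.card_fin, nsmul_eq_mul, mul_one,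
    mul_zero, add_zero]
  have h2 : (2 : ZMod 2) = 0 := rfl
  push_cast
  linear_combination (k + 1) * h2

/-- **The grid routing system is unsolvable**: summing all equations, every edge value is counted
twice (`= 0` over `𝔽₂`) while the charges sum to `1`. [Urquhart 1987, Lemma 4.1 (odd charge)]
[folklore] -/
theorem not_systemSat_gridSystem : ¬ SystemSat (gridSystem k) Finset.univ := by
  rintro ⟨z, hz⟩
  have hall : ∀ r : RowIdx k, ∑ e ∈ edgesOf k r, z (varEquiv k e) = charge k r := fun r =>
    (holds_gridSystem_iff k r z).1 (hz _ (Finset.mem_univ _))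
  have hsum : ∑ r : RowIdx k, ∑ e ∈ edgesOf k r, z (varEquiv k e) = 1 := by
    rw [← sum_charge k]
    exact Finset.sum_congr rfl fun r _ => hall r
  -- exchange the sums: every edge is counted twice
  have hswap : ∑ r : RowIdx k, ∑ e ∈ edgesOf k r, z (varEquiv k e) =
      ∑ e : VarIdx k, (Finset.univ.filter fun r : RowIdx k => e ∈ edgesOf k r).card •
        z (varEquiv k e) := by
    rw [Finset.sum_comm' (t' := Finset.univ)
      (s' := fun e => Finset.univ.filter fun r : RowIdx k => e ∈ edgesOf k r)]
    · refine Finset.sum_congr rfl fun e _ => ?_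
      rw [Finset.sum_const]
    · intro r e
      simp
  rw [hswap] at hsum
  have hzero : ∑ e : VarIdx k, (Finset.univ.filter fun r : RowIdx k => e ∈ edgesOf k r).card •
      z (varEquiv k e) = 0 := by
    refine Finset.sum_eq_zero fun e _ => ?_
    rw [card_filter_mem_edgesOf, two_nsmul]
    exact CharTwo.add_self_eq_zero _
  rw [hzero] at hsum
  exact zero_ne_one hsum

end Summit.PneNP.PneNP.Theorems.GridRouting
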